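import Mathlib.Analysis.Convex.Gauge
import Mathlib.Analysis.LocallyConvex.Separation
import Mathlib.Analysis.Convex.Topology
import Mathlib.LinearAlgebra.Matrix.NonsingularInverse
import Mathlib.Topology.Algebra.Module.FiniteDimension
import Literature.Analysis.FluidPDE.FiniteFourierModeEulerGeneric

/-!
# Kishimoto–Yoneda, §4: the Minkowski functional of `S^{conv}` and a supporting functional

Support file for `FiniteFourierModeEuler` (N. Kishimoto, T. Yoneda, J. Math. Fluid Mech. 24
(2022) 74 = arXiv:2110.08039). The proof of **Proposition 4.8** uses the Minkowski functional
`N(n) = inf {r > 0 : n ∈ r S^{conv}}` of the polyhedron `S^{conv}` ("`N` is a norm on `ℝ³` and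
`S^{conv} = {N ≤ 1}`, `∂S^{conv} = {N = 1}`") and "the (unique) linear functional `f` on `ℝ³`
satisfying `f ≡ 1` on `F`" for a face `F`. We PROVE what is needed about these objects for a
finite symmetric `S ⊂ ℝ³` containing three linearly independent points, with Mathlib's `gauge`
and the geometric Hahn–Banach theorem in place of the face `F`:

* `convexHull_mem_nhds_zero`: `S^{conv}` is a neighbourhood of `0` (it contains the image of the
  `ℓ¹`-ball under the basis `s₁, s₂, s₃ ∈ S`);
* `exists_dot_repr`: a continuous linear functional on `ℝ³` is `x ↦ φ · x`;
* `exists_supporting_of_gauge_eq_one`: at a point `y` with `N(y) = 1` there is `φ` with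
  `φ · s ≤ φ · y` for all `s ∈ S` and `φ · y > 0` (a supporting plane of `S^{conv}` at the boundary
  point `y`; the face `F ∋ n₀/N(n₀)` of the paper);
* `gauge_pos_of_mem`, `gauge_le_one_of_mem'`, `div_gauge_mem_convexHull`: `0 < N(s) ≤ 1` on
  `S`, and `x / r ∈ S^{conv}` whenever `0 < N(x) ≤ r`.

## References

* [KishimotoYoneda2022] N. Kishimoto, T. Yoneda, J. Math. Fluid Mech. 24 (2022) 74 =
  arXiv:2110.08039, §4 proof of Prop. 4.8 (the Minkowski functional `N`, the functional `f`).
-/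

noncomputable section

open Matrix Finset Set

namespace Literature.Analysis.FluidPDE

namespace KY

/-! ### Linear functionals on `ℝ³` are dot products -/

/-- [folklore] -/
theorem exists_dot_repr (f : (Fin 3 → ℝ) →L[ℝ] ℝ) : ∃ φ : Fin 3 → ℝ, ∀ x, f x = φ ⬝ᵥ x := by
  refine ⟨fun i => f (Pi.single i 1), fun x => ?_⟩
  have hx : x = ∑ i, x i • (Pi.single i (1 : ℝ) : Fin 3 → ℝ) := by
    ext j; simp [Finset.sum_apply, Pi.single_apply]
  conv_lhs => rw [hx]
  simp only [map_sum, map_smul, smul_eq_mul, dotProduct, mul_comm (x _)]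

/-! ### `S^{conv}` is a neighbourhood of the origin -/

/-- If the symmetric set `S` contains three vectors with non-zero triple product, then the convex
hull of `S` is a neighbourhood of `0` ("`S^{conv}` … containing the origin", `N` is a norm).
[cite: KishimotoYoneda2022, §4 proof of Prop. 4.8] -/
theorem convexHull_mem_nhds_zero {S : Finset (Fin 3 → ℝ)} (hsymm : ∀ n ∈ S, -n ∈ S)
    {s₁ s₂ s₃ : Fin 3 → ℝ} (h₁ : s₁ ∈ S) (h₂ : s₂ ∈ S) (h₃ : s₃ ∈ S)
    (hdet : s₁ ⬝ᵥ (s₂ ⨯₃ s₃) ≠ 0) :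
    convexHull ℝ (S : Set (Fin 3 → ℝ)) ∈ nhds (0 : Fin 3 → ℝ) := by
  classical
  set K := convexHull ℝ (S : Set (Fin 3 → ℝ)) with hK
  have hKconv : Convex ℝ K := convex_convexHull ℝ _
  -- the matrix with rows `s₁, s₂, s₃` and its transpose are invertible
  set M : Matrix (Fin 3) (Fin 3) ℝ := ![s₁, s₂, s₃] with hM
  have hMdet : M.det ≠ 0 := by rwa [hM, ← triple_product_eq_det]
  have hMTdet : Mᵀ.det ≠ 0 := by rwa [Matrix.det_transpose]
  -- coefficients: `x = Mᵀ c` for `c = (Mᵀ)⁻¹ x`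
  let coef : (Fin 3 → ℝ) →ₗ[ℝ] (Fin 3 → ℝ) := Matrix.mulVecLin (Mᵀ)⁻¹
  have hcoef : ∀ x, Mᵀ.mulVec (coef x) = x := by
    intro x
    simp only [coef, Matrix.mulVecLin_apply, Matrix.mulVec_mulVec]
    rw [Matrix.mul_nonsing_inv _ (by simpa [Matrix.isUnit_iff_isUnit_det, isUnit_iff_ne_zero] using hMTdet)]
    simp
  have hexpand : ∀ c : Fin 3 → ℝ, Mᵀ.mulVec c = ∑ i, c i • M i := by
    intro c; ext j
    simp [Matrix.mulVec, dotProduct, Matrix.transpose_apply, Finset.sum_apply, mul_comm]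
  -- the set of `x` with `∑ |coef x i| < 1` is an open neighbourhood of `0` inside `K`
  have hcont : Continuous fun x => ∑ i, |coef x i| := by
    have hc : Continuous coef := LinearMap.continuous_of_finiteDimensional _
    fun_prop
  have hopen : IsOpen {x : Fin 3 → ℝ | ∑ i, |coef x i| < 1} := isOpen_lt hcont continuous_const
  have h0 : (0 : Fin 3 → ℝ) ∈ {x : Fin 3 → ℝ | ∑ i, |coef x i| < 1} := by simp [coef]
  refine Filter.mem_of_superset (hopen.mem_nhds h0) ?_
  intro x hx
  simp only [Set.mem_setOf_eq] at hx
  have hrow : ∀ i, M i ∈ (S : Set (Fin 3 → ℝ)) := by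
    intro i; fin_cases i
    · simpa [hM] using h₁
    · simpa [hM] using h₂
    · simpa [hM] using h₃
  have hSK : (S : Set (Fin 3 → ℝ)) ⊆ K := subset_convexHull ℝ _
  have h0K : (0 : Fin 3 → ℝ) ∈ K := by
    have := hKconv (hSK (hrow 0)) (hSK (hsymm _ (hrow 0))) (by norm_num : (0 : ℝ) ≤ 1 / 2)
      (by norm_num : (0 : ℝ) ≤ 1 / 2) (by norm_num)
    simpa using this
  -- `x = ∑ |cᵢ| • tᵢ + (1 - ∑ |cᵢ|) • 0` with `tᵢ = ± sᵢ ∈ K`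
  set c := coef x with hc
  let tpt : Fin 3 → (Fin 3 → ℝ) := fun i => if 0 ≤ c i then M i else -M i
  have htK : ∀ i, tpt i ∈ K := by
    intro i; simp only [tpt]; split_ifs
    · exact hSK (hrow i)
    · exact hSK (hsymm _ (hrow i))
  have habs : ∀ i, |c i| • tpt i = c i • M i := by
    intro i; simp only [tpt]; split_ifs with h
    · rw [abs_of_nonneg h]
    · rw [abs_of_neg (not_le.1 h), neg_smul, smul_neg, neg_neg]
  let wt : Fin 4 → ℝ := ![1 - ∑ i, |c i|, |c 0|, |c 1|, |c 2|]
  let z : Fin 4 → (Fin 3 → ℝ) := ![0, tpt 0, tpt 1, tpt 2]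
  have hσ : ∑ i, |c i| < 1 := hx
  have hw0 : ∀ i ∈ (Finset.univ : Finset (Fin 4)), 0 ≤ wt i := by
    intro i _; fin_cases i
    · exact sub_nonneg.2 hσ.le
    all_goals simp [wt]
  have hw1 : ∑ i, wt i = 1 := by
    simp only [wt, Fin.sum_univ_four, Fin.sum_univ_three, Matrix.cons_val_zero, Matrix.cons_val_one,
      Matrix.head_cons, Matrix.cons_val_two, Matrix.tail_cons, Matrix.cons_val_three]
    ring
  have hz : ∀ i ∈ (Finset.univ : Finset (Fin 4)), z i ∈ K := by
    intro i _; fin_cases i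
    · exact h0K
    · exact htK 0
    · exact htK 1
    · exact htK 2
  have hsum := hKconv.sum_mem hw0 hw1 hz
  have hxeq : ∑ i, wt i • z i = x := by
    simp only [wt, z, Fin.sum_univ_four, Matrix.cons_val_zero, Matrix.cons_val_one, Matrix.head_cons,
      Matrix.cons_val_two, Matrix.tail_cons, Matrix.cons_val_three, smul_zero, zero_add, habs]
    have := hcoef x
    rw [hexpand] at this
    rw [← hc, Fin.sum_univ_three] at this
    exact this
  rw [hxeq] at hsum
  exact hsum


/-! ### A supporting functional at a boundary point of `S^{conv}` -/

/-- **Supporting plane.** If `S^{conv}` is a neighbourhood of `0` and `y` is not an interior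
point of `S^{conv}`, there is a linear functional `x ↦ φ·x` with `φ·s ≤ φ·y` for all `s ∈ S` and
`φ·y > 0` (the functional `f ≡ 1` on the face through `n₀/N(n₀)` in the proof of Prop. 4.8, up to
normalisation). [cite: KishimotoYoneda2022, §4 proof of Prop. 4.8] -/
theorem exists_supporting {S : Finset (Fin 3 → ℝ)}
    (hK : convexHull ℝ (S : Set (Fin 3 → ℝ)) ∈ nhds (0 : Fin 3 → ℝ)) {y : Fin 3 → ℝ}
    (hy : y ∉ interior (convexHull ℝ (S : Set (Fin 3 → ℝ)))) :
    ∃ φ : Fin 3 → ℝ, (∀ s ∈ S, φ ⬝ᵥ s ≤ φ ⬝ᵥ y) ∧ 0 < φ ⬝ᵥ y := by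
  set K := convexHull ℝ (S : Set (Fin 3 → ℝ)) with hKdef
  have hKconv : Convex ℝ K := convex_convexHull ℝ _
  have h0 : (0 : Fin 3 → ℝ) ∈ interior K := mem_interior_iff_mem_nhds.2 hK
  obtain ⟨f, hf⟩ := geometric_hahn_banach_open_point hKconv.interior isOpen_interior hy
  obtain ⟨φ, hφ⟩ := exists_dot_repr f
  refine ⟨φ, fun s hs => ?_, ?_⟩
  · -- `s ∈ K ⊆ closure (interior K)` and `f ≤ f y` on the closure
    have hcl : K ⊆ closure (interior K) := by
      rw [hKconv.closure_interior_eq_closure_of_nonempty_interior ⟨0, h0⟩]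
      exact subset_closure
    have hsK : s ∈ closure (interior K) := hcl (subset_convexHull ℝ _ hs)
    have hle : ∀ a ∈ closure (interior K), f a ≤ f y :=
      fun a ha => le_on_closure (f := f) (g := fun _ => f y) (fun b hb => (hf b hb).le)
        f.continuous.continuousOn continuousOn_const ha
    have := hle s hsK
    rwa [hφ, hφ] at this
  · have := hf 0 h0
    rwa [map_zero, hφ] at this

/-! ### The Minkowski functional of `S^{conv}` -/

/-- `N(x) > 0` for `x ≠ 0`. [cite: KishimotoYoneda2022, §4 proof of Prop. 4.8 ("`N` is a norm")] -/
theorem gauge_convexHull_pos {S : Finset (Fin 3 → ℝ)}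
    (hK : convexHull ℝ (S : Set (Fin 3 → ℝ)) ∈ nhds (0 : Fin 3 → ℝ)) {x : Fin 3 → ℝ} (hx : x ≠ 0) :
    0 < gauge (convexHull ℝ (S : Set (Fin 3 → ℝ))) x :=
  (gauge_pos (absorbent_nhds_zero hK)
    ((S.finite_toSet.isCompact_convexHull (𝕜 := ℝ)).isVonNBounded ℝ)).2 hx

/-- `N ≤ r` means `x / r ∈ S^{conv}` (`S^{conv}` is closed). [cite: KishimotoYoneda2022, §4 proof of Prop. 4.8 ("`S^{conv} = {N ≤ 1}`")] -/
theorem inv_smul_mem_convexHull_of_gauge_le {S : Finset (Fin 3 → ℝ)}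
    (hK : convexHull ℝ (S : Set (Fin 3 → ℝ)) ∈ nhds (0 : Fin 3 → ℝ)) {x : Fin 3 → ℝ} {r : ℝ}
    (hr : 0 < r) (hx : gauge (convexHull ℝ (S : Set (Fin 3 → ℝ))) x ≤ r) :
    r⁻¹ • x ∈ convexHull ℝ (S : Set (Fin 3 → ℝ)) := by
  have hconv : Convex ℝ (convexHull ℝ (S : Set (Fin 3 → ℝ))) := convex_convexHull ℝ _
  have hclosed : IsClosed (convexHull ℝ (S : Set (Fin 3 → ℝ))) := S.finite_toSet.isClosed_convexHull (𝕜 := ℝ)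
  have h1 : gauge (convexHull ℝ (S : Set (Fin 3 → ℝ))) (r⁻¹ • x) ≤ 1 := by
    rw [gauge_smul_of_nonneg (inv_nonneg.2 hr.le), smul_eq_mul]
    rw [inv_mul_le_iff₀ hr]; simpa using hx
  have := (gauge_le_one_iff_mem_closure hconv hK).1 h1
  rwa [hclosed.closure_eq] at this

/-- `N(s) ≤ 1` for `s ∈ S`. [cite: KishimotoYoneda2022, §4 proof of Prop. 4.8] -/
theorem gauge_convexHull_le_one {S : Finset (Fin 3 → ℝ)} {s : Fin 3 → ℝ} (hs : s ∈ S) :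
    gauge (convexHull ℝ (S : Set (Fin 3 → ℝ))) s ≤ 1 :=
  gauge_le_one_of_mem (subset_convexHull ℝ _ hs)

/-- The normalised point `x / N(x)` is NOT an interior point of `S^{conv}` (it lies on the
boundary `{N = 1}`). [cite: KishimotoYoneda2022, §4 proof of Prop. 4.8 ("`∂S^{conv} = {N = 1}`")] -/
theorem inv_gauge_smul_notMem_interior {S : Finset (Fin 3 → ℝ)}
    (hK : convexHull ℝ (S : Set (Fin 3 → ℝ)) ∈ nhds (0 : Fin 3 → ℝ)) {x : Fin 3 → ℝ} (hx : x ≠ 0) :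
    (gauge (convexHull ℝ (S : Set (Fin 3 → ℝ))) x)⁻¹ • x ∉
      interior (convexHull ℝ (S : Set (Fin 3 → ℝ))) := by
  have hconv : Convex ℝ (convexHull ℝ (S : Set (Fin 3 → ℝ))) := convex_convexHull ℝ _
  have hg := gauge_convexHull_pos hK hx
  have h1 : gauge (convexHull ℝ (S : Set (Fin 3 → ℝ)))
      ((gauge (convexHull ℝ (S : Set (Fin 3 → ℝ))) x)⁻¹ • x) = 1 := by
    rw [gauge_smul_of_nonneg (inv_nonneg.2 hg.le), smul_eq_mul, inv_mul_cancel₀ hg.ne']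
  rw [← gauge_lt_one_iff_mem_interior hconv hK, h1]
  exact lt_irrefl 1

end KY

end Literature.Analysis.FluidPDE
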